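import Summits.QuantumFields.BalabanUV.Beta.GAN24.CombChargeAntisymPairForm
import Summits.QuantumFields.BalabanUV.Beta.GAN24.T2RecChargeStep

/-!
# `BalabanUV.Beta.GAN24.PairFormSourceOfMember` — binder row G-an2-4 ∕ (CONV-C), W-slot (α-0), ROW (C) AT LEVELS `≥ 1`, RULING R-gan24p1-g40-1's two-index tower:
# **THE SOURCE PAIR FORM FROM THE MEMBER PAIR FORM — road-P2's socket S4 (`hSrc`) SERVED BY THE TOWER's constant-read row, AT GENERIC COLOUR CONSTANTS** (the converse of
# road-P2 g49's `CombChargePairFormTower.pairFormLS_member_of_source`, which needed the pins: if the leg-and-bond symmetrised zero-mode charge of EVERY member level is an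
# antisymmetric-pair form, then so is that of every B-frame SOURCE, with NO pin — the charge factor rides along as a scalar) (G-an2-4 OWNER `b2b-balaban-gan24-p1`, gen 40;
# journal [GAN24P1-G40-INTENT4])

NOT IN PRINT; OUR BOOKKEEPING ([folklore] finite index algebra over road-P2 g36's `T2RecChargeStep.zmodeSym_sourceB_eq` BY NAME; 0 `def`, 0 cited fact, 0 `def … : Prop`,
0 sorry).  HONEST FRAMING (cell contract, verbatim): «discharging `BetaPertH` makes Bałaban's UV stability UNCONDITIONAL — a real constructive-QFT result; it is NOT the
continuum limit and NOT the Clay problem.»  HONEST DEPENDENCY (verbatim): «continuum YM on T⁴ ⇐ BetaPertH ∧ nine spine estimates (0/9 proved); BetaPertH ⇐ (D1) ∧ (D4) ∧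
CAP+tail; G-an2-4 gates asym, D1 and NE2/3/4.»

WHY.  `PairFormPeriodTower.pairFormLS_tower₂` (✓ p378210) delivers, at its constant-read row, the MEMBER pair form at every level (`hPair`, road-P2's S3).  Road-P2's shape of
record for the END is S4: the SOURCE pair form `hSrc` (`CombChargePairFormTower.rowCLegSymEven_of_sourcePairForm_crossed` ∕ F11).  By `zmodeSym_sourceB_eq` the
bond-symmetrised zero mode of the source `U_{j+1} − lin4(cE₂Lc^{2(d+1)}) K♮_j Lc U_j` is `zmodeSym(U_{j+1}) − u·zmodeSym(U_j)` with the SCALAR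
`u = N^{d+1}·cE₂·Lc^{2(d+1)}·Lc^{−4(d+2)}` (`= 1` at the pin `cE₂ = Lc^{d+5}` — `T2RecChargeLedger.charge_factor_eq_one_of_pinEq` — but no pin is needed for the SHAPE); so
`LS(source) = LS(U_{j+1}) − u·LS(U_j)` and the difference of two pair forms is a pair form.
* **`sourceCrossed_of_memberCrossed`**: F10 §4's second binder `hSrcX` (the source's crossed orbit sums vanish) ⟸ the member's crossed orbit sums at `l+2`, `l+1` are in
  the ratio of the charge factor `u` (`hXu`; `u = 1` at the pin = road-P2's `hX`) — the output of the tower's crossed-value ledger.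
* **`sourcePairForm_of_memberPairForm`** (`d = 3`, cell `Lc`, generic `cE cVH cΛ cE₂ cB Tc`, border `vh₂S` with its `LocStencil₂` ∕ covariance letters `hB hBt`, root `r ∈ box`,
  `1 ≤ Lc`): `(∀ i, ∃ R antisym², LS(zmode Lc U_i) = R-form) → ∀ l, ∃ S antisym², LS(zmode Lc (U_{l+2} − lin4 … U_{l+1})) = S-form` — F10 §4's `hSrc` binder text VERBATIM.
Discharges NOTHING of (C)_{≥1} (the member pair form is a hypothesis); asserts NO value; NEVER «G-an2-4 closed» as (CONV-C); NOT D1, NOT `BetaPertH`, NOT continuum, NOT Clay.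
2026-08-24; no existing file touched.
-/

noncomputable section

open Finset
open scoped BigOperators
open Literature.MathematicalPhysics.QuantumFieldTheory
open Literature.MathematicalPhysics.QuantumFieldTheory.Balaban1983to89
open Literature.MathematicalPhysics.QuantumFieldTheory.Balaban1983to89.Beta
open ExpKernelCalculus (MKer shiftK)
open OneStepResolventKernel (Fib)
open OneStepKernelFamily (KInvStep)
open AffineAveraging (Site box toSite)
open AveragingMixedJetTables (mixFFAt)
open BalabanCompositeJets (LocStencil₂)
open Summit.QuantumFields.BalabanUV.Beta.HessKerDressedUnits (unitK)
open Summit.QuantumFields.BalabanUV.Beta.SecondOrderUnits (unitS₂)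
open Summit.QuantumFields.BalabanUV.Beta.SpineRooted (T2RecAt)
open Summit.QuantumFields.BalabanUV.Beta.GAN24.CombesThomas (sfStep smStep)
open Summit.QuantumFields.BalabanUV.Beta.GAN24.T2RecursionAffine (lin4)
open Summit.QuantumFields.BalabanUV.Beta.GAN24.BiStencilZeroMode (Tab zmode)
open Summit.QuantumFields.BalabanUV.Beta.GAN24.T2RecChargeStep (zmodeSym_sourceB_eq)
open Summit.QuantumFields.BalabanUV.Beta.GAN24.CombChargeAntisymPairForm (antisym_add_fst antisym_add_snd)

namespace Summit.QuantumFields.BalabanUV.Beta.GAN24.PairFormSourceOfMember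

variable {Lc : ℕ} [NeZero Lc] {r : Fin (3 + 1) → ℕ}

/-- NOT IN PRINT; OUR BOOKKEEPING.  **`hSrc` FROM `hPair` AT EVERY LEVEL, NO PIN**: if the leg-and-bond symmetrised charge `LS(zmode Lc U_i)` of EVERY member level `i` is
an antisymmetric-pair form (`hPair` — the constant-read row of `PairFormPeriodTower.pairFormLS_tower₂`), then for every `l` the symmetrised charge of the B-frame source
`U_{l+2} − lin4 (cE₂Lc⁸) (unitK_{l+1} K♮_{l+1}) Lc U_{l+1}` is an antisymmetric-pair form (road-P2 F10 §4's `hSrc` binder VERBATIM; witness `R_{l+2} − u·R_{l+1}`,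
`u = Lc⁴·cE₂·Lc⁸·(Lc⁵)⁻⁴` the charge factor of `zmodeSym_sourceB_eq` at cell `Lc`). -/
theorem sourcePairForm_of_memberPairForm (hLc : 1 ≤ Lc) (hr : r ∈ box (3 + 1) Lc) (cE cVH cΛ cE₂ cB : ℝ) (Tc : Fin 4 → Fin 4 → Fin 4 → Fin 4 → ℝ)
    {vh₂S : Tab 3} (hB : ∃ C δ : ℝ, 0 < δ ∧ LocStencil₂ vh₂S C δ)
    (hBt : ∀ (κ : Fin (3 + 1)) (u : Fin (3 + 1) → ℤ) (κ' : Fin (3 + 1)) (u' t : Fin (3 + 1) → ℤ),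
      vh₂S κ (u + (Lc : ℤ) • t) κ' (u' + (Lc : ℤ) • t) = shiftK (-((Lc : ℤ) • t)) (vh₂S κ u κ' u'))
    (hPair : ∀ i : ℕ, ∃ R : Fin (3 + 1) → Fin (3 + 1) → Fin (3 + 1) → Fin (3 + 1) → ℝ,
      (∀ a b c e, R b a c e = -R a b c e) ∧ (∀ a b c e, R a b e c = -R a b c e) ∧
      ∀ κ κ' κ₁ κ₂ : Fin (3 + 1),
        zmode Lc (unitS₂ (sfStep Lc i) (smStep 3 Lc i) (T2RecAt 3 Lc (toSite r) cE cVH cΛ cE₂ cB Tc vh₂S (mixFFAt (toSite r) Lc) i)) κ κ' (Sum.inl κ₁) (Sum.inl κ₂)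
          + zmode Lc (unitS₂ (sfStep Lc i) (smStep 3 Lc i) (T2RecAt 3 Lc (toSite r) cE cVH cΛ cE₂ cB Tc vh₂S (mixFFAt (toSite r) Lc) i)) κ' κ (Sum.inl κ₁) (Sum.inl κ₂)
          + (zmode Lc (unitS₂ (sfStep Lc i) (smStep 3 Lc i) (T2RecAt 3 Lc (toSite r) cE cVH cΛ cE₂ cB Tc vh₂S (mixFFAt (toSite r) Lc) i)) κ κ' (Sum.inl κ₂) (Sum.inl κ₁)
          + zmode Lc (unitS₂ (sfStep Lc i) (smStep 3 Lc i) (T2RecAt 3 Lc (toSite r) cE cVH cΛ cE₂ cB Tc vh₂S (mixFFAt (toSite r) Lc) i)) κ' κ (Sum.inl κ₂) (Sum.inl κ₁))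
        = R κ κ₁ κ' κ₂ + R κ' κ₁ κ κ₂ + (R κ κ₂ κ' κ₁ + R κ' κ₂ κ κ₁))
    (l : ℕ) :
    ∃ S : Fin (3 + 1) → Fin (3 + 1) → Fin (3 + 1) → Fin (3 + 1) → ℝ,
      (∀ a b c e, S b a c e = -S a b c e) ∧ (∀ a b c e, S a b e c = -S a b c e) ∧
      ∀ κ κ' κ₁ κ₂ : Fin (3 + 1),
      (zmode Lc ((unitS₂ (sfStep Lc ((l + 1) + 1)) (smStep 3 Lc ((l + 1) + 1)) (T2RecAt 3 Lc (toSite r) cE cVH cΛ cE₂ cB Tc vh₂S (mixFFAt (toSite r) Lc) ((l + 1) + 1)))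
             - lin4 (cE₂ * (Lc : ℝ) ^ (2 * (3 + 1))) (unitK (sfStep Lc (l + 1)) (smStep 3 Lc (l + 1)) (KInvStep (d := 3) Lc (l + 1))) Lc
               (unitS₂ (sfStep Lc (l + 1)) (smStep 3 Lc (l + 1)) (T2RecAt 3 Lc (toSite r) cE cVH cΛ cE₂ cB Tc vh₂S (mixFFAt (toSite r) Lc) (l + 1)))) κ κ' (Sum.inl κ₁) (Sum.inl κ₂)
         + zmode Lc ((unitS₂ (sfStep Lc ((l + 1) + 1)) (smStep 3 Lc ((l + 1) + 1)) (T2RecAt 3 Lc (toSite r) cE cVH cΛ cE₂ cB Tc vh₂S (mixFFAt (toSite r) Lc) ((l + 1) + 1)))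
             - lin4 (cE₂ * (Lc : ℝ) ^ (2 * (3 + 1))) (unitK (sfStep Lc (l + 1)) (smStep 3 Lc (l + 1)) (KInvStep (d := 3) Lc (l + 1))) Lc
               (unitS₂ (sfStep Lc (l + 1)) (smStep 3 Lc (l + 1)) (T2RecAt 3 Lc (toSite r) cE cVH cΛ cE₂ cB Tc vh₂S (mixFFAt (toSite r) Lc) (l + 1)))) κ' κ (Sum.inl κ₁) (Sum.inl κ₂))
      + (zmode Lc ((unitS₂ (sfStep Lc ((l + 1) + 1)) (smStep 3 Lc ((l + 1) + 1)) (T2RecAt 3 Lc (toSite r) cE cVH cΛ cE₂ cB Tc vh₂S (mixFFAt (toSite r) Lc) ((l + 1) + 1)))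
             - lin4 (cE₂ * (Lc : ℝ) ^ (2 * (3 + 1))) (unitK (sfStep Lc (l + 1)) (smStep 3 Lc (l + 1)) (KInvStep (d := 3) Lc (l + 1))) Lc
               (unitS₂ (sfStep Lc (l + 1)) (smStep 3 Lc (l + 1)) (T2RecAt 3 Lc (toSite r) cE cVH cΛ cE₂ cB Tc vh₂S (mixFFAt (toSite r) Lc) (l + 1)))) κ κ' (Sum.inl κ₂) (Sum.inl κ₁)
         + zmode Lc ((unitS₂ (sfStep Lc ((l + 1) + 1)) (smStep 3 Lc ((l + 1) + 1)) (T2RecAt 3 Lc (toSite r) cE cVH cΛ cE₂ cB Tc vh₂S (mixFFAt (toSite r) Lc) ((l + 1) + 1)))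
             - lin4 (cE₂ * (Lc : ℝ) ^ (2 * (3 + 1))) (unitK (sfStep Lc (l + 1)) (smStep 3 Lc (l + 1)) (KInvStep (d := 3) Lc (l + 1))) Lc
               (unitS₂ (sfStep Lc (l + 1)) (smStep 3 Lc (l + 1)) (T2RecAt 3 Lc (toSite r) cE cVH cΛ cE₂ cB Tc vh₂S (mixFFAt (toSite r) Lc) (l + 1)))) κ' κ (Sum.inl κ₂) (Sum.inl κ₁))
        = S κ κ₁ κ' κ₂ + S κ' κ₁ κ κ₂ + (S κ κ₂ κ' κ₁ + S κ' κ₂ κ κ₁) := by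
  -- the two symmetrised halves of the source, by road-P2's one-step law (legs `(κ₁,κ₂)` and `(κ₂,κ₁)`)
  have h12 := fun κ κ' κ₁ κ₂ : Fin (3 + 1) =>
    zmodeSym_sourceB_eq (d := 3) hLc hr cE cVH cΛ cE₂ cB Tc hB hBt Lc (l + 1) κ κ' κ₁ κ₂
  obtain ⟨R₂, hR₂1, hR₂2, hR₂⟩ := hPair (l + 1 + 1)
  obtain ⟨R₁, hR₁1, hR₁2, hR₁⟩ := hPair (l + 1)
  set u : ℝ := ((Lc : ℝ) ^ (3 + 1)) * ((cE₂ * (Lc : ℝ) ^ (2 * (3 + 1))) * (((Lc : ℝ) ^ (3 + 1 + 1))⁻¹) ^ 4) with hu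
  refine ⟨fun a b c e => R₂ a b c e - u * R₁ a b c e, ?_, ?_, fun κ κ' κ₁ κ₂ => ?_⟩
  · intro a b c e; dsimp only; rw [hR₂1, hR₁1]; ring
  · intro a b c e; dsimp only; rw [hR₂2, hR₁2]; ring
  · have e1 := h12 κ κ' κ₁ κ₂
    have e2 := h12 κ κ' κ₂ κ₁
    have f2 := hR₂ κ κ' κ₁ κ₂
    have f1 := hR₁ κ κ' κ₁ κ₂
    dsimp only
    linear_combination e1 + e2 + f2 - u * f1

/-- NOT IN PRINT; OUR BOOKKEEPING.  **`hSrcX` FROM THE MEMBER's CROSSED-VALUE LEDGER, NO PIN**: for every `l` and `a ≠ b`, the crossed orbit sum of the B-frame source's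
zero-mode charge (road-P2 F10 §4's `hSrcX` binder VERBATIM) VANISHES as soon as the member's crossed orbit sums at levels `l+2` and `l+1` are in the ratio of the charge factor
`u = Lc⁴·cE₂·Lc⁸·(Lc⁵)⁻⁴` of `zmodeSym_sourceB_eq` (`hXu`; at the pin `u = 1` this is road-P2's `hX` — conservation of the member's crossed orbit sums — and
`PairFormPeriodTower.crossed_tower₂_const ∕ _eq_of_candidate` are the ledger that delivers it). -/
theorem sourceCrossed_of_memberCrossed (hLc : 1 ≤ Lc) (hr : r ∈ box (3 + 1) Lc) (cE cVH cΛ cE₂ cB : ℝ) (Tc : Fin 4 → Fin 4 → Fin 4 → Fin 4 → ℝ)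
    {vh₂S : Tab 3} (hB : ∃ C δ : ℝ, 0 < δ ∧ LocStencil₂ vh₂S C δ)
    (hBt : ∀ (κ : Fin (3 + 1)) (u : Fin (3 + 1) → ℤ) (κ' : Fin (3 + 1)) (u' t : Fin (3 + 1) → ℤ),
      vh₂S κ (u + (Lc : ℤ) • t) κ' (u' + (Lc : ℤ) • t) = shiftK (-((Lc : ℤ) • t)) (vh₂S κ u κ' u'))
    (hXu : ∀ (l : ℕ) (a b : Fin (3 + 1)), a ≠ b →
      zmode Lc (unitS₂ (sfStep Lc (l + 1 + 1)) (smStep 3 Lc (l + 1 + 1)) (T2RecAt 3 Lc (toSite r) cE cVH cΛ cE₂ cB Tc vh₂S (mixFFAt (toSite r) Lc) (l + 1 + 1))) a b (Sum.inl a) (Sum.inl b)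
          + zmode Lc (unitS₂ (sfStep Lc (l + 1 + 1)) (smStep 3 Lc (l + 1 + 1)) (T2RecAt 3 Lc (toSite r) cE cVH cΛ cE₂ cB Tc vh₂S (mixFFAt (toSite r) Lc) (l + 1 + 1))) b a (Sum.inl a) (Sum.inl b)
        + (zmode Lc (unitS₂ (sfStep Lc (l + 1 + 1)) (smStep 3 Lc (l + 1 + 1)) (T2RecAt 3 Lc (toSite r) cE cVH cΛ cE₂ cB Tc vh₂S (mixFFAt (toSite r) Lc) (l + 1 + 1))) a b (Sum.inl b) (Sum.inl a)
          + zmode Lc (unitS₂ (sfStep Lc (l + 1 + 1)) (smStep 3 Lc (l + 1 + 1)) (T2RecAt 3 Lc (toSite r) cE cVH cΛ cE₂ cB Tc vh₂S (mixFFAt (toSite r) Lc) (l + 1 + 1))) b a (Sum.inl b) (Sum.inl a))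
      = ((Lc : ℝ) ^ (3 + 1)) * ((cE₂ * (Lc : ℝ) ^ (2 * (3 + 1))) * (((Lc : ℝ) ^ (3 + 1 + 1))⁻¹) ^ 4) *
        (zmode Lc (unitS₂ (sfStep Lc (l + 1)) (smStep 3 Lc (l + 1)) (T2RecAt 3 Lc (toSite r) cE cVH cΛ cE₂ cB Tc vh₂S (mixFFAt (toSite r) Lc) (l + 1))) a b (Sum.inl a) (Sum.inl b)
            + zmode Lc (unitS₂ (sfStep Lc (l + 1)) (smStep 3 Lc (l + 1)) (T2RecAt 3 Lc (toSite r) cE cVH cΛ cE₂ cB Tc vh₂S (mixFFAt (toSite r) Lc) (l + 1))) b a (Sum.inl a) (Sum.inl b)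
          + (zmode Lc (unitS₂ (sfStep Lc (l + 1)) (smStep 3 Lc (l + 1)) (T2RecAt 3 Lc (toSite r) cE cVH cΛ cE₂ cB Tc vh₂S (mixFFAt (toSite r) Lc) (l + 1))) a b (Sum.inl b) (Sum.inl a)
            + zmode Lc (unitS₂ (sfStep Lc (l + 1)) (smStep 3 Lc (l + 1)) (T2RecAt 3 Lc (toSite r) cE cVH cΛ cE₂ cB Tc vh₂S (mixFFAt (toSite r) Lc) (l + 1))) b a (Sum.inl b) (Sum.inl a))))
    (l : ℕ) (a b : Fin (3 + 1)) (hab : a ≠ b) :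
    (zmode Lc ((unitS₂ (sfStep Lc ((l + 1) + 1)) (smStep 3 Lc ((l + 1) + 1)) (T2RecAt 3 Lc (toSite r) cE cVH cΛ cE₂ cB Tc vh₂S (mixFFAt (toSite r) Lc) ((l + 1) + 1)))
             - lin4 (cE₂ * (Lc : ℝ) ^ (2 * (3 + 1))) (unitK (sfStep Lc (l + 1)) (smStep 3 Lc (l + 1)) (KInvStep (d := 3) Lc (l + 1))) Lc
               (unitS₂ (sfStep Lc (l + 1)) (smStep 3 Lc (l + 1)) (T2RecAt 3 Lc (toSite r) cE cVH cΛ cE₂ cB Tc vh₂S (mixFFAt (toSite r) Lc) (l + 1)))) a b (Sum.inl a) (Sum.inl b)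
         + zmode Lc ((unitS₂ (sfStep Lc ((l + 1) + 1)) (smStep 3 Lc ((l + 1) + 1)) (T2RecAt 3 Lc (toSite r) cE cVH cΛ cE₂ cB Tc vh₂S (mixFFAt (toSite r) Lc) ((l + 1) + 1)))
             - lin4 (cE₂ * (Lc : ℝ) ^ (2 * (3 + 1))) (unitK (sfStep Lc (l + 1)) (smStep 3 Lc (l + 1)) (KInvStep (d := 3) Lc (l + 1))) Lc
               (unitS₂ (sfStep Lc (l + 1)) (smStep 3 Lc (l + 1)) (T2RecAt 3 Lc (toSite r) cE cVH cΛ cE₂ cB Tc vh₂S (mixFFAt (toSite r) Lc) (l + 1)))) b a (Sum.inl a) (Sum.inl b))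
      + (zmode Lc ((unitS₂ (sfStep Lc ((l + 1) + 1)) (smStep 3 Lc ((l + 1) + 1)) (T2RecAt 3 Lc (toSite r) cE cVH cΛ cE₂ cB Tc vh₂S (mixFFAt (toSite r) Lc) ((l + 1) + 1)))
             - lin4 (cE₂ * (Lc : ℝ) ^ (2 * (3 + 1))) (unitK (sfStep Lc (l + 1)) (smStep 3 Lc (l + 1)) (KInvStep (d := 3) Lc (l + 1))) Lc
               (unitS₂ (sfStep Lc (l + 1)) (smStep 3 Lc (l + 1)) (T2RecAt 3 Lc (toSite r) cE cVH cΛ cE₂ cB Tc vh₂S (mixFFAt (toSite r) Lc) (l + 1)))) a b (Sum.inl b) (Sum.inl a)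
         + zmode Lc ((unitS₂ (sfStep Lc ((l + 1) + 1)) (smStep 3 Lc ((l + 1) + 1)) (T2RecAt 3 Lc (toSite r) cE cVH cΛ cE₂ cB Tc vh₂S (mixFFAt (toSite r) Lc) ((l + 1) + 1)))
             - lin4 (cE₂ * (Lc : ℝ) ^ (2 * (3 + 1))) (unitK (sfStep Lc (l + 1)) (smStep 3 Lc (l + 1)) (KInvStep (d := 3) Lc (l + 1))) Lc
               (unitS₂ (sfStep Lc (l + 1)) (smStep 3 Lc (l + 1)) (T2RecAt 3 Lc (toSite r) cE cVH cΛ cE₂ cB Tc vh₂S (mixFFAt (toSite r) Lc) (l + 1)))) b a (Sum.inl b) (Sum.inl a)) = 0 := by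
  have e1 := zmodeSym_sourceB_eq (d := 3) hLc hr cE cVH cΛ cE₂ cB Tc hB hBt Lc (l + 1) a b a b
  have e2 := zmodeSym_sourceB_eq (d := 3) hLc hr cE cVH cΛ cE₂ cB Tc hB hBt Lc (l + 1) a b b a
  have hx := hXu l a b hab
  linear_combination e1 + e2 + hx

end Summit.QuantumFields.BalabanUV.Beta.GAN24.PairFormSourceOfMember
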